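import Literature.Analysis.FluidPDE.HolderCZKernel
import Literature.Analysis.FluidPDE.NewtonNearTruncation
import HarnessLib

/-!
# The Hessian of the near-field Newtonian kernel is a Calderón–Zygmund kernel of Hölder theory

Analysis/FluidPDE support file on the discharge path of the named fact
`Literature.Analysis.FluidPDE.MajdaBertozzi2002_holderEulerLocalExistence`
(`ElgindiBlowupContinuationProofs.lean`; Lagrangian decomposition `HolderEulerLagrangian.lean`).
It instantiates the abstract Hölder estimate of `HolderCZKernel.lean` (Majda–Bertozzi,
*Vorticity and Incompressible Flow*, CUP 2002, §4.1.3 **Lemma 4.6** (4.36), p. 129 of the held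
text; Gilbarg–Trudinger 2001, Lemma 4.4) for the kernels
`K_{ab}(z) = ∂_b∂_aΓ₀(z) = newtonNearHess r₀ r₁ a b z` of the compactly supported near part
`Γ₀ = θΓ = newtonNear r₀ r₁` of the Newtonian kernel, using the size/regularity and the
integration-by-parts cancellation bound of `NewtonNearTruncation.lean`:

* `exists_isHolderCZKernel_newtonNearHess`: **`K_{ab}` is an `IsHolderCZKernel` with radius `r₁`
  and constants `C‖a‖‖b‖`**, `C` depending on `r₀, r₁` only;
* `exists_holder_bounds_czDiff_newtonNearHess`: consequently the singular integral on
  differences `S_{ab}f(x) = ∫ ∂_b∂_aΓ₀(x − y)(f(y) − f(x)) dy` of a `γ`-Hölder `f`, `0 < γ < 1`,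
  satisfies `‖S_{ab}f(x)‖ ≤ C‖a‖‖b‖C_f r₁^γ/γ` and
  `‖S_{ab}f(x) − S_{ab}f(x̄)‖ ≤ C‖a‖‖b‖C_f(γ⁻¹ + (1−γ)⁻¹ + 1)|x − x̄|^γ` — Majda–Bertozzi's (4.35)
  (with `ε = R`) and (4.36) for the localised kernel; `S_{ab}f` is `∂_b∂_a(Γ₀ ⋆ f)`
  (`NewtonNearPotential*.lean`).

## Mathlib / tree search

Tree (all used): `IsHolderCZKernel`, `IsHolderCZKernel.norm_czDiff_le`,
`IsHolderCZKernel.norm_czDiff_sub_le` (`HolderCZKernel`); `isSingularKernel_newtonNearHess`,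
`abs_integral_truncate_newtonNearHess_le`, `exists_norm_fderiv_radialCutoff_two_three_le`
(`NewtonNearTruncation`); `exists_abs_newtonNearGrad_le`, `exists_abs_newtonNearHess_le`,
`exists_norm_fderiv_newtonNearHess_le`, `newtonNearHess_eq_zero_of_le` (`NewtonNearDerivatives`).

## References

* A. J. Majda, A. L. Bertozzi, *Vorticity and Incompressible Flow* (CUP 2002), §4.1.3
  Lemma 4.6 (4.35)–(4.36), p. 129; proof §4.5 p. 144–145. [MajdaBertozziCUP2002]
* D. Gilbarg, N. S. Trudinger, *Elliptic Partial Differential Equations of Second Order*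
  (2001), Lemma 4.4. [GilbargTrudinger2001]
-/

noncomputable section

open MeasureTheory Set Function Filter Metric Real
open _root_.Topology
open scoped NNReal ENNReal

namespace Literature.Analysis.FluidPDE

open NewtonPotentialHolder

variable {r₀ r₁ : ℝ}

/-! ### The Hessian kernel is an `IsHolderCZKernel` -/

/-- **`∂_b∂_aΓ₀` is a compactly supported Calderón–Zygmund kernel of Hölder theory**, with
support radius `r₁` and constants of the form `C‖a‖‖b‖`, `C` depending on `r₀, r₁` only:
size and regularity by `isSingularKernel_newtonNearHess`, support by
`newtonNearHess_eq_zero_of_le`, cancellation by `abs_integral_truncate_newtonNearHess_le`. [folklore] -/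
theorem exists_isHolderCZKernel_newtonNearHess (h₀ : 0 < r₀) (h₁ : r₀ < r₁) :
    ∃ A B A₀ : ℝ, 0 ≤ A ∧ 0 ≤ B ∧ 0 ≤ A₀ ∧ ∀ a b : (EuclideanSpace ℝ (Fin 3)),
      IsHolderCZKernel (newtonNearHess r₀ r₁ a b) r₁ (A * ‖a‖ * ‖b‖) (B * ‖a‖ * ‖b‖)
        (A₀ * ‖a‖ * ‖b‖) := by
  obtain ⟨C₁, hC₁0, hC₁⟩ := exists_abs_newtonNearGrad_le h₀ h₁
  obtain ⟨C₂, hC₂0, hC₂⟩ := exists_abs_newtonNearHess_le h₀ h₁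
  obtain ⟨C₃, hC₃0, hC₃⟩ := exists_norm_fderiv_newtonNearHess_le h₀ h₁
  obtain ⟨M, hM0, hM⟩ := exists_norm_fderiv_radialCutoff_two_three_le
  refine ⟨C₂, 16 * C₃, 36 * π * M * C₁, hC₂0, by positivity, by positivity, fun a b => ?_⟩
  refine ⟨?_, fun z hz => newtonNearHess_eq_zero_of_le h₀ h₁ a b hz, fun w d hd hw => ?_⟩
  · have := isSingularKernel_newtonNearHess h₀ h₁ hC₂ hC₃0 hC₃ a b
    rwa [show 16 * C₃ * ‖a‖ * ‖b‖ = 16 * C₃ * ‖a‖ * ‖b‖ from rfl] at this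
  · have h := abs_integral_truncate_newtonNearHess_le h₀ h₁ hd hw hM0 hM hC₁0 hC₁ hC₂ a b
    rwa [show 36 * π * M * C₁ * ‖a‖ * ‖b‖ = 36 * π * M * C₁ * ‖a‖ * ‖b‖ from rfl]

/-- **Hölder estimates for `∂_b∂_a(Γ₀ ⋆ f)` on differences** (Majda–Bertozzi Lemma 4.6 (4.35),
(4.36) for the localised kernel): there is `C = C(r₀, r₁)` such that for every `γ`-Hölder `f`
with constant `C_f`, `0 < γ < 1`, and all `a, b`, the singular integral
`S_{ab}f(x) = ∫ ∂_b∂_aΓ₀(x − y)(f(y) − f(x)) dy` satisfies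
`‖S_{ab}f(x)‖ ≤ C‖a‖‖b‖ C_f r₁^γ/γ` and
`‖S_{ab}f(x) − S_{ab}f(x̄)‖ ≤ C‖a‖‖b‖ C_f (γ⁻¹ + (1 − γ)⁻¹ + 1)|x − x̄|^γ`. [cite: MajdaBertozziCUP2002, §4.1.3 Lemma 4.6 (4.35)–(4.36) (p. 129)] -/
theorem exists_holder_bounds_czDiff_newtonNearHess {F : Type*} [NormedAddCommGroup F]
    [NormedSpace ℝ F] [CompleteSpace F] (h₀ : 0 < r₀) (h₁ : r₀ < r₁) :
    ∃ C : ℝ, 0 ≤ C ∧ ∀ (a b : (EuclideanSpace ℝ (Fin 3))) (f : (EuclideanSpace ℝ (Fin 3)) → F) (Cf γ : ℝ≥0), HolderWith Cf γ f → 0 < γ → γ < 1 →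
      (∀ x, ‖czDiff (newtonNearHess r₀ r₁ a b) f x‖ ≤
          C * ‖a‖ * ‖b‖ * Cf * (r₁ ^ (γ : ℝ) / γ)) ∧
      ∀ x x', ‖czDiff (newtonNearHess r₀ r₁ a b) f x - czDiff (newtonNearHess r₀ r₁ a b) f x'‖ ≤
        C * ‖a‖ * ‖b‖ * Cf * (1 / γ + 1 / (1 - γ) + 1) * ‖x - x'‖ ^ (γ : ℝ) := by
  obtain ⟨A, B, A₀, hA, hB, hA₀, hK⟩ := exists_isHolderCZKernel_newtonNearHess h₀ h₁
  set c₃ : ℝ := 3 * (volume : Measure (EuclideanSpace ℝ (Fin 3))).real (ball 0 1) with hc₃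
  have hc₃0 : 0 ≤ c₃ := three_mul_volume_real_ball_nonneg
  have hr₁ : 0 < r₁ := h₀.trans h₁
  -- one constant dominating all three
  set C : ℝ := 7 * A * c₃ + B * c₃ + A₀ with hC
  have hC0 : 0 ≤ C := by positivity
  refine ⟨C, hC0, fun a b f Cf γ hf hγ hγ1 => ⟨fun x => ?_, fun x x' => ?_⟩⟩
  · have h := (hK a b).norm_czDiff_le hr₁ hf hγ hγ1 x
    refine h.trans ?_
    have hγ' : (0 : ℝ) < γ := by exact_mod_cast hγ
    have : A * ‖a‖ * ‖b‖ * Cf * c₃ ≤ C * ‖a‖ * ‖b‖ * Cf := by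
      have h1 : A * c₃ ≤ C := by
        rw [hC]
        nlinarith [mul_nonneg hA hc₃0, mul_nonneg hB hc₃0]
      calc A * ‖a‖ * ‖b‖ * Cf * c₃ = (A * c₃) * (‖a‖ * ‖b‖ * Cf) := by ring
        _ ≤ C * (‖a‖ * ‖b‖ * Cf) := by gcongr
        _ = C * ‖a‖ * ‖b‖ * Cf := by ring
    exact mul_le_mul_of_nonneg_right this (by positivity)
  · have h := (hK a b).norm_czDiff_sub_le hf hγ hγ1 x x'
    refine h.trans ?_
    have hγ' : (0 : ℝ) < γ := by exact_mod_cast hγ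
    have hγ1' : (γ : ℝ) < 1 := by exact_mod_cast hγ1
    have h1γ : 0 < 1 - (γ : ℝ) := by linarith
    have hab : 0 ≤ ‖a‖ * ‖b‖ := by positivity
    -- compare the two constants termwise
    have key : 7 * (A * ‖a‖ * ‖b‖) * c₃ / γ + B * ‖a‖ * ‖b‖ * c₃ / (1 - γ) + A₀ * ‖a‖ * ‖b‖ ≤
        C * ‖a‖ * ‖b‖ * (1 / γ + 1 / (1 - γ) + 1) := by
      have e : C * ‖a‖ * ‖b‖ * (1 / γ + 1 / (1 - γ) + 1) =
          C * ‖a‖ * ‖b‖ / γ + C * ‖a‖ * ‖b‖ / (1 - γ) + C * ‖a‖ * ‖b‖ := by ring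
      rw [e]
      have i1 : 7 * A * c₃ ≤ C := by rw [hC]; nlinarith [mul_nonneg hB hc₃0]
      have i2 : B * c₃ ≤ C := by rw [hC]; nlinarith [mul_nonneg hA hc₃0]
      have i3 : A₀ ≤ C := by rw [hC]; nlinarith [mul_nonneg hA hc₃0, mul_nonneg hB hc₃0]
      refine add_le_add (add_le_add ?_ ?_) ?_
      · rw [show 7 * (A * ‖a‖ * ‖b‖) * c₃ = (7 * A * c₃) * (‖a‖ * ‖b‖) by ring,
          show C * ‖a‖ * ‖b‖ = C * (‖a‖ * ‖b‖) by ring]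
        exact div_le_div_of_nonneg_right (mul_le_mul_of_nonneg_right i1 hab) hγ'.le
      · rw [show B * ‖a‖ * ‖b‖ * c₃ = (B * c₃) * (‖a‖ * ‖b‖) by ring,
          show C * ‖a‖ * ‖b‖ = C * (‖a‖ * ‖b‖) by ring]
        exact div_le_div_of_nonneg_right (mul_le_mul_of_nonneg_right i2 hab) h1γ.le
      · rw [show A₀ * ‖a‖ * ‖b‖ = A₀ * (‖a‖ * ‖b‖) by ring,
          show C * ‖a‖ * ‖b‖ = C * (‖a‖ * ‖b‖) by ring]
        exact mul_le_mul_of_nonneg_right i3 hab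
    calc (Cf : ℝ) * (7 * (A * ‖a‖ * ‖b‖) * c₃ / γ + B * ‖a‖ * ‖b‖ * c₃ / (1 - γ) +
          A₀ * ‖a‖ * ‖b‖) * ‖x - x'‖ ^ (γ : ℝ)
        ≤ Cf * (C * ‖a‖ * ‖b‖ * (1 / γ + 1 / (1 - γ) + 1)) * ‖x - x'‖ ^ (γ : ℝ) := by
          refine mul_le_mul_of_nonneg_right (mul_le_mul_of_nonneg_left key Cf.coe_nonneg) ?_
          exact Real.rpow_nonneg (norm_nonneg _) _
      _ = C * ‖a‖ * ‖b‖ * Cf * (1 / γ + 1 / (1 - γ) + 1) * ‖x - x'‖ ^ (γ : ℝ) := by ring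

end Literature.Analysis.FluidPDE
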